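import Literature.NumberTheory.EllipticCurves.ModularFormsGamma1RankInput
import Literature.NumberTheory.EllipticCurves.ModularFormsLevelRankGeneral
import HarnessLib

/-!
# The rank input for `Γ₁(N)` itself: the all-character family `E_{k(χ)}^χ Δ^{μ-1-i}Δ_N^i`, the
# level-one basis of `M(Γ₁(N)) = ⊕_{k ∈ ℤ} M_k(Γ₁(N))` on `φ(N)μ` generators, and their weights
# modulo `4` and `6` (`N ≥ 4`)

`ModularFormsGamma1RankInput` produced a `Level.RankInput` for `±Γ₁(N)` from the forms
`E_4^χ Δ^{μ-1-i}Δ_N^i` with `χ` *even* — the even weights. For the odd weights one must work with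
`Γ₁(N)` itself (`-1 ∉ Γ₁(N)`, `N ≥ 3`, index `[SL₂(ℤ):Γ₁(N)] = φ(N)μ`), over whose coset space a
rank input needs column weights of both parities (`Level.RankInput'`,
`ModularFormsLevelRankGeneral`). This file supplies it with the **all-character family**

  `G_{χ,i} = E_{k(χ)}^χ · Δ^{μ-1-i}Δ_N^i`, `χ` any Dirichlet character mod `N`, `i < μ`,
  `k(χ) = 4` for even `χ`, `k(χ) = 3` for odd `χ` (`eisWt`; `E_k^χ ≠ 0` needs `χ(-1) = (-1)^k`),

of weights `w(χ) = k(χ) + 12(μ - 1)` (`allCharForm`, `allCharWeight`):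

* `allCharForm_slash_mul`, **`allCharForm_conj_indep`** — the conjugates separate the family:
  a relation `∑ c_{χ,i}(G_{χ,i} ∣ h)(τ) = 0` for all `h ∈ SL₂(ℤ)` forces `c = 0` at a good point `τ`
  (as in `charExplicitForm_conj_indep`, now with orthogonality over the *full* character group of
  `(ℤ/N)ˣ` — `h = σ_d β`, `d` of both signs — and the `Γ₀(N)`-Vandermonde); `exists_good_point'`.
* `fact_T_mem_gamma1`, `index_gamma1_eq` (`[SL₂(ℤ):Γ₁(N)] = φ(N)μ`, `N ≥ 3`),
  `finEquivAllCharIndex`, **`rankInputGamma1 N hN : Level.RankInput' (Gamma1 N)`** (`N ≥ 3`).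
* consequences from `ModularFormsLevelFreeModuleGeneral`/`…RankGeneral`:
  **`exists_isLevelBasis_gamma1`** — a level-one basis of `M(Γ₁(N)) = ⊕_k M_k(Γ₁(N))` indexed by
  `Fin [SL₂(ℤ):Γ₁(N)]`, weights `≥ 0`, with `𝒟 ≢ 0` (`exists_basisDet_ne_zero_gamma1`);
  `ST_pow_smul_ne_gamma1` (`ST` acts freely on `SL₂(ℤ)/Γ₁(N)` for `N ≥ 4`: `(ST)³ = -1 ∉ Γ₁(N)` and
  no conjugate of `ST` lies in `±Γ₁(N)`), and **`card_weights_gamma1`**: for `N ≥ 4` the generator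
  weights satisfy `4#{k_j ≡ r (4)} = [SL₂(ℤ):Γ₁(N)] = 6#{k_j ≡ r (6)}` for every `r` — in particular
  `[SL₂(ℤ):Γ₁(N)]/2` generators of each parity.

Everything is proved; no named facts.

## References

* T. Gannon, *The theory of vector-valued modular forms for the modular group*, Contrib. Math.
  Comput. Sci. 8 (2014), 247–286, Thm. 3.4, §3.5.
* F. Diamond, J. Shurman, *A first course in modular forms*, GTM 228 (2005), §3.9, §4.3.
-/

noncomputable section

open UpperHalfPlane hiding I
open ModularForm Complex Matrix.SpecialLinearGroup Filter CongruenceSubgroup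
open scoped MatrixGroups ModularForm Topology Manifold

namespace Literature.NumberTheory.EllipticCurves.ModularForms

/-! ### The all-character family -/

section Family

variable {N : ℕ} [NeZero N]

open scoped Classical in
/-- The weight of the Eisenstein factor attached to `χ`: `4` for even `χ`, `3` for odd `χ`. [folklore] -/
def eisWt (χ : DirichletCharacter ℂ N) : ℤ := if χ.Even then 4 else 3

omit [NeZero N] in
/-- `k(χ) = 4` for even `χ`. [folklore] -/
theorem eisWt_of_even {χ : DirichletCharacter ℂ N} (h : χ.Even) : eisWt χ = 4 := by
  classical
  exact if_pos h

omit [NeZero N] in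
/-- An odd character is not even (`-1 ≠ 1` in `ℂ`). [folklore] -/
theorem not_even_of_odd {χ : DirichletCharacter ℂ N} (h : χ.Odd) : ¬ χ.Even := fun he ↦ by
  have h1 : χ (-1) = 1 := he
  have h2 : χ (-1) = -1 := h
  rw [h1] at h2
  norm_num at h2

omit [NeZero N] in
/-- `k(χ) = 3` for odd `χ`. [folklore] -/
theorem eisWt_of_odd {χ : DirichletCharacter ℂ N} (h : χ.Odd) : eisWt χ = 3 := by
  classical
  exact if_neg (not_even_of_odd h)

omit [NeZero N] in
/-- `3 ≤ k(χ)`. [folklore] -/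
theorem three_le_eisWt (χ : DirichletCharacter ℂ N) : 3 ≤ eisWt χ := by
  rcases χ.even_or_odd with h | h
  · rw [eisWt_of_even h]; norm_num
  · rw [eisWt_of_odd h]

omit [NeZero N] in
/-- `χ(-1) = (-1)^{k(χ)}` (the parity condition for `E_{k(χ)}^χ ≠ 0`). [folklore] -/
theorem apply_neg_one_eq_pow_eisWt (χ : DirichletCharacter ℂ N) : χ (-1) = (-1) ^ eisWt χ := by
  rcases χ.even_or_odd with h | h
  · rw [eisWt_of_even h, show χ (-1) = 1 from h]; norm_num
  · rw [eisWt_of_odd h, show χ (-1) = -1 from h]; norm_num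

variable (N) in
/-- The forms **`G_{χ,i} = E_{k(χ)}^χ · Δ^{μ-1-i} Δ_N^i`** on `Γ₁(N)`, `χ` any character mod `N`,
`i < μ`. [folklore] -/
def allCharForm (χ : DirichletCharacter ℂ N) (i : Fin (gamma0Index N)) : ℍ → ℂ :=
  eisensteinChar N (eisWt χ) χ * explicitForm N (gamma0Index N) i

variable (N) in
/-- Their weights `w(χ) = k(χ) + 12(μ - 1)`. [folklore] -/
def allCharWeight (χ : DirichletCharacter ℂ N) : ℤ := eisWt χ + 12 * ((gamma0Index N : ℤ) - 1)

/-- `w(χ) ≥ 0`. [folklore] -/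
theorem allCharWeight_nonneg (χ : DirichletCharacter ℂ N) : 0 ≤ allCharWeight N χ := by
  have hμ : 1 ≤ gamma0Index N := by
    have h : (Gamma0 N).index = gamma0Index N := index_gamma0_eq_gamma0Index_holds N
    rw [← h]
    exact Nat.one_le_iff_ne_zero.mpr Subgroup.index_ne_zero_of_finite
  have : (1 : ℤ) ≤ gamma0Index N := by exact_mod_cast hμ
  have h3 := three_le_eisWt χ
  unfold allCharWeight
  linarith

omit [NeZero N] in
/-- `w(χ) ≡ 0 (2)` for even `χ`. [folklore] -/
theorem allCharWeight_emod_two_of_even {χ : DirichletCharacter ℂ N} (h : χ.Even) :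
    allCharWeight N χ % 2 = 0 := by
  rw [allCharWeight, eisWt_of_even h]; omega

omit [NeZero N] in
/-- `w(χ) ≡ 1 (2)` for odd `χ`. [folklore] -/
theorem allCharWeight_emod_two_of_odd {χ : DirichletCharacter ℂ N} (h : χ.Odd) :
    allCharWeight N χ % 2 = 1 := by
  rw [allCharWeight, eisWt_of_odd h]; omega

/-- `G_{χ,i} ∈ M_{w(χ)}(Γ₁(N))`. [folklore] -/
theorem allCharForm_mem (χ : DirichletCharacter ℂ N) (i : Fin (gamma0Index N)) :
    allCharForm N χ i ∈ gamma1Space N (allCharWeight N χ) :=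
  mul_mem_formSpace (coe_mem_formSpace (eisensteinCharMF N (eisWt χ) χ (three_le_eisWt χ)))
    (gamma0Space_le_gamma1Space N _ (explicitForm_mem N (gamma0Index N) i))

/-- `G_{χ,i} ∣ (σβ) = χ(d) · (E_{k(χ)}^χ ∣ β) · (G_i ∣ β)` for `σ ∈ Γ₀(N)` with lower-right entry `d`.
[folklore] -/
theorem allCharForm_slash_mul (χ : DirichletCharacter ℂ N) (i : Fin (gamma0Index N))
    {σ : SL(2, ℤ)} (hσ : σ ∈ Gamma0 N) (β : SL(2, ℤ)) :
    allCharForm N χ i ∣[allCharWeight N χ] (σ * β) =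
      χ ((σ 1 1 : ℤ) : ZMod N) •
        (eisensteinChar N (eisWt χ) χ ∣[eisWt χ] β *
          explicitForm N (gamma0Index N) i ∣[12 * ((gamma0Index N : ℤ) - 1)] β) := by
  have hG := slash_eq_of_mem_gamma0Space (explicitForm_mem N (gamma0Index N) i)
  have hG' : explicitForm N (gamma0Index N) i ∣[12 * ((gamma0Index N : ℤ) - 1)] σ =
      explicitForm N (gamma0Index N) i := by
    rw [ModularForm.SL_slash]
    exact hG σ hσ
  rw [allCharForm, allCharWeight, SlashAction.slash_mul, ModularForm.mul_slash_SL2,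
    eisensteinChar_slash_of_mem_gamma0 hσ, hG', smul_mul_assoc, ModularForm.SL_smul_slash,
    ModularForm.mul_slash_SL2]

/-- **The conjugates separate the all-character family**: if
`∑_{χ ∈ s} ∑_i c_{χ,i} (G_{χ,i} ∣ h)(τ) = 0` for all `h ∈ SL₂(ℤ)`, where at `τ` the conjugates of
`Δ_N` are pairwise distinct and `(E_{k(χ)}^χ ∣ g_b)(τ) ≠ 0` for `χ ∈ s`, `b < μ`, then `c_{χ,i} = 0`
for `χ ∈ s` (orthogonality of the characters of `(ℤ/N)ˣ`, then the `Γ₀(N)`-Vandermonde). [folklore] -/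
theorem allCharForm_conj_indep (s : Finset (DirichletCharacter ℂ N))
    (c : DirichletCharacter ℂ N → Fin (gamma0Index N) → ℂ) (τ : ℍ)
    (hinj : Function.Injective fun x : SL(2, ℤ) ⧸ Gamma0 N ↦ conjDeltaDil N x τ)
    (hE : ∀ χ ∈ s, ∀ b : Fin (gamma0Index N),
      (eisensteinChar N (eisWt χ) χ ∣[eisWt χ] gamma0Rep N b) τ ≠ 0)
    (hrel : ∀ h : SL(2, ℤ),
      ∑ χ ∈ s, ∑ i, c χ i * (allCharForm N χ i ∣[allCharWeight N χ] h) τ = 0) :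
    ∀ χ ∈ s, ∀ i, c χ i = 0 := by
  classical
  -- Step 1: isolate each character by orthogonality
  have hiso : ∀ χ₀ ∈ s, ∀ β : SL(2, ℤ), (eisensteinChar N (eisWt χ₀) χ₀ ∣[eisWt χ₀] β) τ ≠ 0 →
      ∑ i, c χ₀ i * (explicitForm N (gamma0Index N) i ∣[12 * ((gamma0Index N : ℤ) - 1)] β) τ = 0 := by
    intro χ₀ hχ₀ β hβ
    have htw : ∀ d : ZMod N, ∑ χ ∈ s, χ d * ((eisensteinChar N (eisWt χ) χ ∣[eisWt χ] β) τ *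
        ∑ i, c χ i * (explicitForm N (gamma0Index N) i ∣[12 * ((gamma0Index N : ℤ) - 1)] β) τ) = 0 := by
      intro d
      by_cases hd : IsUnit d
      · obtain ⟨σ, hσ, hσd⟩ := exists_mem_gamma0_apply_one_one_eq (N := N) hd.unit
        have h := hrel (σ * β)
        rw [← h]
        refine Finset.sum_congr rfl fun χ _ ↦ ?_
        rw [Finset.mul_sum, Finset.mul_sum]
        refine Finset.sum_congr rfl fun i _ ↦ ?_
        rw [allCharForm_slash_mul χ i hσ β, hσd, IsUnit.unit_spec]
        simp only [Pi.smul_apply, Pi.mul_apply, smul_eq_mul]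
        ring
      · exact Finset.sum_eq_zero fun χ _ ↦ by rw [MulChar.map_nonunit χ hd, zero_mul]
    have hsum : ∑ d : ZMod N, χ₀⁻¹ d * ∑ χ ∈ s, χ d * ((eisensteinChar N (eisWt χ) χ ∣[eisWt χ] β) τ *
        ∑ i, c χ i * (explicitForm N (gamma0Index N) i ∣[12 * ((gamma0Index N : ℤ) - 1)] β) τ) = 0 := by
      simp [htw]
    have hswap : ∑ d : ZMod N, χ₀⁻¹ d * ∑ χ ∈ s, χ d * ((eisensteinChar N (eisWt χ) χ ∣[eisWt χ] β) τ *
        ∑ i, c χ i * (explicitForm N (gamma0Index N) i ∣[12 * ((gamma0Index N : ℤ) - 1)] β) τ) =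
        ∑ χ ∈ s, (∑ d : ZMod N, (χ₀⁻¹ * χ) d) * ((eisensteinChar N (eisWt χ) χ ∣[eisWt χ] β) τ *
          ∑ i, c χ i * (explicitForm N (gamma0Index N) i ∣[12 * ((gamma0Index N : ℤ) - 1)] β) τ) := by
      calc _ = ∑ d : ZMod N, ∑ χ ∈ s, χ₀⁻¹ d * (χ d * ((eisensteinChar N (eisWt χ) χ ∣[eisWt χ] β) τ *
            ∑ i, c χ i * (explicitForm N (gamma0Index N) i ∣[12 * ((gamma0Index N : ℤ) - 1)] β) τ)) := by
            refine Finset.sum_congr rfl fun d _ ↦ ?_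
            rw [Finset.mul_sum]
        _ = ∑ χ ∈ s, ∑ d : ZMod N, χ₀⁻¹ d * (χ d * ((eisensteinChar N (eisWt χ) χ ∣[eisWt χ] β) τ *
            ∑ i, c χ i * (explicitForm N (gamma0Index N) i ∣[12 * ((gamma0Index N : ℤ) - 1)] β) τ)) :=
            Finset.sum_comm
        _ = _ := by
            refine Finset.sum_congr rfl fun χ _ ↦ ?_
            rw [Finset.sum_mul]
            refine Finset.sum_congr rfl fun d _ ↦ ?_
            rw [MulChar.mul_apply]
            ring
    rw [hswap, Finset.sum_eq_single χ₀ ?_ (fun h ↦ absurd hχ₀ h)] at hsum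
    · rw [inv_mul_cancel, MulChar.sum_one_eq_card_units] at hsum
      have hcard : ((Fintype.card (ZMod N)ˣ : ℕ) : ℂ) ≠ 0 := by exact_mod_cast Fintype.card_ne_zero
      have h1 := (mul_eq_zero.mp hsum).resolve_left hcard
      exact (mul_eq_zero.mp h1).resolve_left hβ
    · intro χ _ hne
      rw [MulChar.sum_eq_zero_of_ne_one, zero_mul]
      intro h1
      apply hne
      calc χ = χ₀ * (χ₀⁻¹ * χ) := by rw [← mul_assoc, mul_inv_cancel, one_mul]
        _ = χ₀ := by rw [h1, mul_one]
  -- Step 2: the `Γ₀(N)`-conjugate matrix of the explicit forms is invertible at `τ`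
  intro χ₀ hχ₀ i₀
  have hΔ : ModularForm.discriminant τ ≠ 0 := discriminant_ne_zero τ
  let f : Fin (gamma0Index N) → ℂ := fun b ↦ conjDeltaDil N ((cosetEquiv N).symm b) τ / ModularForm.discriminant τ
  have hf : Function.Injective f := by
    intro b b' h
    have := hinj ((div_left_inj' hΔ).mp h :
      conjDeltaDil N ((cosetEquiv N).symm b) τ = conjDeltaDil N ((cosetEquiv N).symm b') τ)
    exact (cosetEquiv N).symm.injective this
  have key : (fun i ↦ c χ₀ i) = 0 := by
    refine Matrix.eq_zero_of_forall_index_sum_mul_pow_eq_zero hf fun b ↦ ?_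
    have h0 := hiso χ₀ hχ₀ (gamma0Rep N b) (hE χ₀ hχ₀ b)
    have h0' : ModularForm.discriminant τ ^ ((gamma0Index N) - 1) * ∑ i, c χ₀ i * f b ^ (i : ℕ) = 0 := by
      rw [Finset.mul_sum, ← h0]
      refine Finset.sum_congr rfl fun i _ ↦ ?_
      rw [explicitForm_slash_gamma0Rep_apply]
      ring
    exact (mul_eq_zero.mp h0').resolve_left (pow_ne_zero _ hΔ)
  exact congrFun key i₀

/-- **A good point exists** for any finite set of characters: the conjugates of `Δ_N` are pairwise
distinct and the `E_{k(χ)}^χ ∣ g_b` do not vanish (`E_{k(χ)}^χ ≠ 0` by the parity of `k(χ)`). [folklore] -/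
theorem exists_good_point' (s : Finset (DirichletCharacter ℂ N)) :
    ∃ τ : ℍ, Function.Injective (fun x : SL(2, ℤ) ⧸ Gamma0 N ↦ conjDeltaDil N x τ) ∧
      ∀ χ ∈ s, ∀ b : Fin (gamma0Index N),
        (eisensteinChar N (eisWt χ) χ ∣[eisWt χ] gamma0Rep N b) τ ≠ 0 := by
  classical
  obtain ⟨W, hW⟩ : ∃ W : ℍ → ℂ, W = ∏ q ∈ (Finset.univ : Finset ((SL(2, ℤ) ⧸ Gamma0 N) ×
      (SL(2, ℤ) ⧸ Gamma0 N))).filter (fun q ↦ q.1 ≠ q.2), (conjDeltaDil N q.1 - conjDeltaDil N q.2) :=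
    ⟨_, rfl⟩
  have hWprop : W ≠ 0 ∧ MDiff W := by
    rw [hW]
    exact prod_ne_zero_of_mdifferentiable
      ((Finset.univ : Finset ((SL(2, ℤ) ⧸ Gamma0 N) × (SL(2, ℤ) ⧸ Gamma0 N))).filter (fun q ↦ q.1 ≠ q.2))
      (f := fun q ↦ conjDeltaDil N q.1 - conjDeltaDil N q.2)
      (fun q _ ↦ (mdifferentiable_conjDeltaDil N q.1).sub (mdifferentiable_conjDeltaDil N q.2))
      (fun q hq ↦ by
        rw [Finset.mem_filter] at hq
        exact sub_ne_zero.mpr fun h ↦ hq.2 (conjDeltaDil_injective N h))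
  have hEne : ∀ χ : DirichletCharacter ℂ N, ∀ β : SL(2, ℤ),
      eisensteinChar N (eisWt χ) χ ∣[eisWt χ] β ≠ 0 := by
    intro χ β h
    apply eisensteinChar_ne_zero (N := N) (χ := χ) (k := eisWt χ) (three_le_eisWt χ)
      (apply_neg_one_eq_pow_eisWt χ)
    have := congrArg (fun f : ℍ → ℂ ↦ f ∣[eisWt χ] (β⁻¹ : SL(2, ℤ))) h
    simp only [← SlashAction.slash_mul, mul_inv_cancel, SlashAction.slash_one,
      SlashAction.zero_slash] at this
    exact this
  obtain ⟨P, hP⟩ : ∃ P : ℍ → ℂ, P = ∏ q ∈ (Finset.univ : Finset (s × Fin (gamma0Index N))),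
      eisensteinChar N (eisWt (q.1 : DirichletCharacter ℂ N)) q.1 ∣[eisWt (q.1 : DirichletCharacter ℂ N)]
        gamma0Rep N q.2 := ⟨_, rfl⟩
  have hPprop : P ≠ 0 ∧ MDiff P := by
    rw [hP]
    exact prod_ne_zero_of_mdifferentiable (Finset.univ : Finset (s × Fin (gamma0Index N)))
      (f := fun q ↦ eisensteinChar N (eisWt (q.1 : DirichletCharacter ℂ N)) q.1 ∣[eisWt (q.1 : DirichletCharacter ℂ N)]
        gamma0Rep N q.2)
      (fun q _ ↦ by
        rw [ModularForm.SL_slash]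
        exact (mdifferentiable_eisensteinChar (N := N) (χ := (q.1 : DirichletCharacter ℂ N))
          (three_le_eisWt _)).slash _ _)
      (fun q _ ↦ hEne q.1 _)
  have hWP : W * P ≠ 0 := fun h ↦
    hPprop.1 (eq_zero_of_mul_eq_zero_of_mdifferentiable hWprop.2 hWprop.1 hPprop.2.continuous h)
  obtain ⟨τ, hτ⟩ : ∃ τ, (W * P) τ ≠ 0 := Function.ne_iff.mp hWP
  rw [Pi.mul_apply, mul_ne_zero_iff] at hτ
  have hinj : Function.Injective (fun x : SL(2, ℤ) ⧸ Gamma0 N ↦ conjDeltaDil N x τ) := by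
    intro x y hxy
    by_contra hne
    apply hτ.1
    rw [hW, Finset.prod_apply]
    exact Finset.prod_eq_zero (Finset.mem_filter.mpr ⟨Finset.mem_univ (x, y), hne⟩) (by simp [hxy])
  have hEτ : ∀ χ ∈ s, ∀ b : Fin (gamma0Index N),
      (eisensteinChar N (eisWt χ) χ ∣[eisWt χ] gamma0Rep N b) τ ≠ 0 := by
    intro χ hχ b hb
    apply hτ.2
    rw [hP, Finset.prod_apply]
    exact Finset.prod_eq_zero (Finset.mem_univ ((⟨χ, hχ⟩ : s), b)) hb
  exact ⟨τ, hinj, hEτ⟩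

end Family

/-! ### The rank input for `Γ₁(N)` -/

section RankInputGamma1

variable (N : ℕ)

/-- `T ∈ Γ₁(N)`. [folklore] -/
instance fact_T_mem_gamma1 : Fact (ModularGroup.T ∈ Gamma1 N) :=
  ⟨by rw [Gamma1_mem]; simp [ModularGroup.T]⟩

variable [NeZero N]

/-- **`[SL₂(ℤ) : Γ₁(N)] = φ(N)μ`** for `N ≥ 3`. [cite: DiamondShurman2005, Ex. 1.2.3] -/
theorem index_gamma1_eq (hN : 3 ≤ N) : (Gamma1 N).index = N.totient * gamma0Index N := by
  rw [← two_mul_index_gamma1pm_eq N hN, two_mul_index_gamma1pm N hN]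

/-- The index set of the all-character family: pairs `(χ, i)`, `χ` a character mod `N`, `i < μ`.
[folklore] -/
abbrev AllCharIndex : Type := DirichletCharacter ℂ N × Fin (gamma0Index N)

open scoped Classical in
/-- `#AllCharIndex = φ(N)μ = [SL₂(ℤ) : Γ₁(N)]` (`N ≥ 3`). [folklore] -/
theorem card_allCharIndex_eq_index (hN : 3 ≤ N) :
    Fintype.card (AllCharIndex N) = (Gamma1 N).index := by
  rw [index_gamma1_eq N hN, Fintype.card_prod, Fintype.card_fin, ← Nat.card_eq_fintype_card,
    DirichletCharacter.card_eq_totient_of_hasEnoughRootsOfUnity ℂ N]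

open scoped Classical in
/-- The reindexing `Fin [SL₂(ℤ) : Γ₁(N)] ≃ AllCharIndex N` (`N ≥ 3`). [folklore] -/
def finEquivAllCharIndex (hN : 3 ≤ N) : Fin (Gamma1 N).index ≃ AllCharIndex N :=
  (Fintype.equivFinOfCardEq (card_allCharIndex_eq_index N hN)).symm

open scoped Classical in
/-- **The rank input for `Γ₁(N)`, `N ≥ 3`**: the all-character family `G_{χ,i}` reindexed by
`Fin [SL₂(ℤ):Γ₁(N)]`, column weights `w(χ)`, conjugate matrix over `SL₂(ℤ)/Γ₁(N)` invertible at a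
good point (a kernel vector is a relation on all cosets, i.e. for all `h ∈ SL₂(ℤ)`).
[cite: Gannon2014, Thm. 3.4(a), §3.5] -/
def rankInputGamma1 (hN : 3 ≤ N) : Level.RankInput' (Gamma1 N) where
  wtG := fun j ↦ allCharWeight N (finEquivAllCharIndex N hN j).1
  G := fun j ↦ allCharForm N (finEquivAllCharIndex N hN j).1 (finEquivAllCharIndex N hN j).2
  wtG_nonneg := fun j ↦ allCharWeight_nonneg _
  mem := fun j ↦ allCharForm_mem _ _
  det_ne_zero := by
    set e := finEquivAllCharIndex N hN with he
    obtain ⟨τ, hinj, hE⟩ := exists_good_point' (N := N) Finset.univ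
    refine ⟨τ, ?_⟩
    set M : Matrix (Fin (Gamma1 N).index) (Fin (Gamma1 N).index) ℂ :=
      Matrix.of fun a i ↦ Level.cosetSlash (Gamma1 N) (allCharWeight N (e i).1)
        (allCharForm N (e i).1 (e i).2) ((Level.cosetEquiv (Gamma1 N)).symm a) τ with hM
    suffices hli : LinearIndependent ℂ (fun i a ↦ M a i) by
      have hU : IsUnit M := Matrix.linearIndependent_cols_iff_isUnit.mp hli
      exact ((Matrix.isUnit_iff_isUnit_det M).mp hU).ne_zero
    rw [Fintype.linearIndependent_iff]
    intro c hc j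
    let C : DirichletCharacter ℂ N → Fin (gamma0Index N) → ℂ := fun χ i ↦ c (e.symm (χ, i))
    have hinvG : ∀ i, ∀ γ ∈ Gamma1 N, allCharForm N (e i).1 (e i).2 ∣[allCharWeight N (e i).1]
        ((γ : SL(2, ℤ)) : GL (Fin 2) ℝ) = allCharForm N (e i).1 (e i).2 :=
      fun i ↦ Level.slash_eq_of_mem_levelSpace (allCharForm_mem _ _)
    have hrel : ∀ h : SL(2, ℤ),
        ∑ χ ∈ (Finset.univ : Finset (DirichletCharacter ℂ N)), ∑ i,
          C χ i * (allCharForm N χ i ∣[allCharWeight N χ] h) τ = 0 := by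
      intro h
      have hcoset := congrFun hc (Level.cosetEquiv (Gamma1 N) ((h⁻¹ : SL(2, ℤ)) : SL(2, ℤ) ⧸ Gamma1 N))
      simp only [Finset.sum_apply, Pi.smul_apply, smul_eq_mul, Pi.zero_apply, hM, Matrix.of_apply,
        Equiv.symm_apply_apply] at hcoset
      rw [← hcoset]
      have hre : ∑ χ ∈ (Finset.univ : Finset (DirichletCharacter ℂ N)), ∑ i,
          C χ i * (allCharForm N χ i ∣[allCharWeight N χ] h) τ =
          ∑ j, c j * (allCharForm N (e j).1 (e j).2 ∣[allCharWeight N (e j).1] h) τ := by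
        rw [← Fintype.sum_prod_type', ← Equiv.sum_comp e]
        refine Finset.sum_congr rfl fun j _ ↦ ?_
        simp only [C, Prod.mk.eta, Equiv.symm_apply_apply]
      rw [hre]
      refine Finset.sum_congr rfl fun i _ ↦ ?_
      rw [Level.cosetSlash_mk (hinvG i), inv_inv, ModularForm.SL_slash]
    have hC := allCharForm_conj_indep Finset.univ C τ hinj hE hrel
    have := hC (e j).1 (Finset.mem_univ _) (e j).2
    simpa only [C, Prod.mk.eta, Equiv.symm_apply_apply] using this

/-- **`M(Γ₁(N)) = ⊕_k M_k(Γ₁(N))` has a level-one basis indexed by `Fin [SL₂(ℤ):Γ₁(N)]`, weights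
`≥ 0`, with `𝒟 ≢ 0`** (`N ≥ 3`): a free `ℂ[E₄, E₆]`-module of rank `φ(N)μ` (Gannon Thm. 3.4(a) for
`ρ = Ind_{Γ₁(N)}^{SL₂(ℤ)} 1`, which has `ρ(-1) ≠ 1`). [cite: Gannon2014, Thm. 3.4(a)] -/
theorem exists_isLevelBasis_gamma1 (hN : 3 ≤ N) :
    ∃ (wt : Fin (Gamma1 N).index → ℤ) (F : Fin (Gamma1 N).index → ℍ → ℂ),
      Level.IsLevelBasis (Gamma1 N) wt F ∧ (∀ i, 0 ≤ wt i) ∧ ∃ τ, Level.basisDet (Gamma1 N) wt F τ ≠ 0 := by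
  obtain ⟨wt, F, hb, hwt⟩ := Level.exists_isLevelBasis_card_eq' (Gamma1 N) (rankInputGamma1 N hN)
  exact ⟨wt, F, hb, hwt, Level.exists_basisDet_ne_zero' hb (rankInputGamma1 N hN)⟩

/-- `𝒟 ≢ 0` for every level-one basis of `M(Γ₁(N))` on `Fin [SL₂(ℤ):Γ₁(N)]` (`N ≥ 3`). [folklore] -/
theorem exists_basisDet_ne_zero_gamma1 (hN : 3 ≤ N) {wt : Fin (Gamma1 N).index → ℤ}
    {F : Fin (Gamma1 N).index → ℍ → ℂ} (hb : Level.IsLevelBasis (Gamma1 N) wt F) :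
    ∃ τ, Level.basisDet (Gamma1 N) wt F τ ≠ 0 :=
  Level.exists_basisDet_ne_zero' hb (rankInputGamma1 N hN)

/-! ### Free actions of `S` and `ST` on `SL₂(ℤ)/Γ₁(N)` and the weights modulo `4` and `6` -/

omit [NeZero N] in
/-- **`ST` acts freely on `SL₂(ℤ)/Γ₁(N)` for `N ≥ 4`**: `(ST)^d`, `0 < d < 6`, fixes no coset
(`(ST)³ = -1 ∉ Γ₁(N)`; a coset fixed by `(ST)^{±1}`, `(ST)^{±2}` would put a conjugate of `ST` into
`±Γ₁(N)`, excluded by `conj_ST_not_mem_gamma1pm`). [cite: Shimura1971, Prop. 1.43] -/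
theorem ST_pow_smul_ne_gamma1 (hN : 4 ≤ N) (d : ℕ) (hd : 0 < d) (hd6 : d < 6)
    (x : SL(2, ℤ) ⧸ Gamma1 N) : (ModularGroup.S * ModularGroup.T) ^ d • x ≠ x := by
  intro hx
  set U : SL(2, ℤ) := ModularGroup.S * ModularGroup.T with hU
  have hU3 : U ^ 3 = -1 := ST_pow_three_eq
  have hN3 : 3 ≤ N := by omega
  induction x using QuotientGroup.induction_on with
  | H a =>
    rw [Level.smul_mk_eq_iff] at hx
    have hnot := conj_ST_not_mem_gamma1pm N hN a
    rw [← hU] at hnot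
    -- `a⁻¹ U a ∈ ±Γ₁(N)` from `a⁻¹ U^d a ∈ Γ₁(N)` in each case
    interval_cases d
    · rw [pow_one] at hx
      exact hnot (gamma1_le_gamma1pm N hx)
    · apply hnot
      right
      have h2 := (Gamma1 N).mul_mem hx hx
      rw [show a⁻¹ * U ^ 2 * a * (a⁻¹ * U ^ 2 * a) = a⁻¹ * (U ^ 3 * U) * a by group, hU3] at h2
      simpa using h2
    · rw [hU3] at hx
      exact neg_one_not_mem_gamma1 N hN3 (by simpa using hx)
    · apply hnot
      right
      rw [show U ^ 4 = U ^ 3 * U by rw [← pow_succ], hU3] at hx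
      simpa using hx
    · apply hnot
      left
      have hU6 : U ^ 6 = 1 := by
        rw [show (6 : ℕ) = 3 * 2 by norm_num, pow_mul, hU3]; simp
      have hU5 : U ^ 5 = U⁻¹ := by
        rw [eq_inv_iff_mul_eq_one, ← pow_succ, hU6]
      rw [hU5] at hx
      have h5 := (Gamma1 N).inv_mem hx
      rwa [show (a⁻¹ * U⁻¹ * a)⁻¹ = a⁻¹ * U * a by group] at h5

omit [NeZero N] in
/-- `S` acts freely on `SL₂(ℤ)/Γ₁(N)` for `N ≥ 3` (`-1 ∉ Γ₁(N)`). [folklore] -/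
theorem S_pow_smul_ne_gamma1 (hN : 3 ≤ N) (d : ℕ) (hd : 0 < d) (hd4 : d < 4)
    (x : SL(2, ℤ) ⧸ Gamma1 N) : ModularGroup.S ^ d • x ≠ x :=
  Level.S_pow_smul_ne_of_neg_one_not_mem (neg_one_not_mem_gamma1 N hN) d hd hd4 x

variable {N}

/-- **The generator weights of `M(Γ₁(N))` modulo `4` and `6`** (`N ≥ 4`): for a level-one basis on
`Fin [SL₂(ℤ):Γ₁(N)]` with weights `≥ 0`, `4#{j : k_j ≡ r (4)} = [SL₂(ℤ):Γ₁(N)] = 6#{j : k_j ≡ r (6)}`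
for every `r` (free `S`- and `ST`-actions; Gannon Thm. 3.4(b) with `ρ(S)`, `ρ(ST)` regular).
[cite: Gannon2014, Thm. 3.4(b)] -/
theorem card_weights_gamma1 (hN : 4 ≤ N) {wt : Fin (Gamma1 N).index → ℤ}
    {F : Fin (Gamma1 N).index → ℍ → ℂ} (hb : Level.IsLevelBasis (Gamma1 N) wt F)
    (hwt : ∀ j, 0 ≤ wt j) (r : ℤ) :
    4 * (Finset.univ.filter fun j ↦ (4 : ℤ) ∣ wt j - r).card = (Gamma1 N).index ∧
    6 * (Finset.univ.filter fun j ↦ (6 : ℤ) ∣ wt j - r).card = (Gamma1 N).index := by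
  have hN3 : 3 ≤ N := by omega
  have hD := exists_basisDet_ne_zero_gamma1 N hN3 hb
  exact ⟨Level.four_mul_card_weights_eq hb hD hwt (neg_one_not_mem_gamma1 N hN3) r,
    Level.six_mul_card_weights_eq hb hD hwt (fun d hd hd6 x ↦ ST_pow_smul_ne_gamma1 N hN d hd hd6 x) r⟩

/-- In particular **`[SL₂(ℤ):Γ₁(N)]/2` generators of each parity** (`N ≥ 4`):
`2#{j : k_j ≡ ε (2)} = [SL₂(ℤ):Γ₁(N)]` for `ε = 0, 1`. [cite: Gannon2014, Thm. 3.4(b)] -/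
theorem two_mul_card_parity_gamma1 (hN : 4 ≤ N) {wt : Fin (Gamma1 N).index → ℤ}
    {F : Fin (Gamma1 N).index → ℍ → ℂ} (hb : Level.IsLevelBasis (Gamma1 N) wt F)
    (hwt : ∀ j, 0 ≤ wt j) (ε : ℤ) (hε : ε = 0 ∨ ε = 1) :
    2 * (Finset.univ.filter fun j ↦ wt j % 2 = ε).card = (Gamma1 N).index := by
  classical
  have h0 := (card_weights_gamma1 hN hb hwt ε).1
  have h2 := (card_weights_gamma1 hN hb hwt (ε + 2)).1
  -- `k ≡ ε (2)` iff `k ≡ ε (4)` or `k ≡ ε + 2 (4)`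
  have hsplit : (Finset.univ.filter fun j ↦ wt j % 2 = ε) =
      (Finset.univ.filter fun j ↦ (4 : ℤ) ∣ wt j - ε) ∪
        (Finset.univ.filter fun j ↦ (4 : ℤ) ∣ wt j - (ε + 2)) := by
    ext j
    simp only [Finset.mem_filter, Finset.mem_univ, true_and, Finset.mem_union]
    rcases hε with rfl | rfl <;> omega
  have hdisj : Disjoint (Finset.univ.filter fun j ↦ (4 : ℤ) ∣ wt j - ε)
      (Finset.univ.filter fun j ↦ (4 : ℤ) ∣ wt j - (ε + 2)) := by
    rw [Finset.disjoint_filter]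
    intro j _ h1 h2
    omega
  rw [hsplit, Finset.card_union_of_disjoint hdisj]
  omega

end RankInputGamma1

end Literature.NumberTheory.EllipticCurves.ModularForms
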